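import Literature.NumberTheory.PAdicHodge.TateAlmostEtaleEtaleStep
import Literature.NumberTheory.PAdicHodge.TateAlmostEtaleTwistedBasis
import Literature.NumberTheory.PAdicHodge.TateInvariantsBase

/-!
# Tate's almost étale lemma (TS1) — prime radical steps `M ⊆ M(c^{1/ℓ})`, `ℓ ≠ p`, through the different

(Companion of `TateAlmostEtaleRadicalStep` (seat edix-p4: the ORTHOGONAL-basis route for `‖α‖ ∉ ‖M‖`); this
file is the DIFFERENT route, which also covers unit radicands with `X^ℓ - c` irreducible; the two are
combined in `TateAlmostEtaleRadicalPackage`.)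

For `K_∞ ⊆ M ⊆ F̄` with the almost-perfectoid package ((Γ) + (U_s)), a prime `ℓ ≠ p`, and `α ∈ F̄` with
`α^ℓ = c ∈ M^×`: the package of `M(α)` ((Γ) and (U_{min s 1 / 2})). Cases: if `[M(α):M] < ℓ` then
`c ∈ M^ℓ` (norm + Bezout) and `M(α) = M(ζ)` for an `ℓ`-th root of unity (`adjoin_rootOfUnity_package`); if
`[M(α):M] = ℓ`, rescale `c` into `‖p‖^δ ≤ ‖c‖ ≤ 1` by an element of `K_∞`, bound the coordinates of an
integer `u = Σ b_j α^j` through the different `ℓ α^{ℓ-1}` (`norm_repr_mul_norm_derivative_le`), write each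
monomial `b_j α^j = β_j (α^{k_j})^p` (`p k_j ≡ j mod ℓ`) and approximate it by a `p`-th power using the
package of `M`, then sum (`norm_sum_pow_sub_sum_pow_le'`). Together with root-of-unity steps
(`TateAlmostEtaleEtaleStep`), Kummer `p`-steps (`TateAlmostEtalePackageStep`) and descent
(`TateAlmostEtaleDescent`) this gives the package of every field lying with prime-to-`p` index in a
radical tower over `K_∞` — the input of the tame hypothesis (C) of `TateSenConditionKummerRoute` granted
the structure of tame extensions. [cite: Tate1967, §3.2] [cite: Scholze2012, Lemma 3.2]
-/

noncomputable section

open Polynomial IntermediateField Module ValuativeRel Field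

namespace Literature.NumberTheory.PAdicHodge

namespace TateAlmostEtale

open Literature.NumberTheory.GaloisRepresentations
open Literature.NumberTheory.GaloisRepresentations.IsNonarchimedeanLocalField

variable {F : Type} [Field F] [ValuativeRel F] [TopologicalSpace F] [IsNonarchimedeanLocalField F]
  [CharZero F] {p : ℕ} [Fact p.Prime] (hp : valuation F p < 1)

variable (M : IntermediateField (PadicBase F p hp) (NormedAlgClosure F))

/-! ### §1 (Γ) ascends along extensions of degree prime to `p` -/

/-- **(Γ) ascends along prime-to-`p` extensions**: if `p ∤ [L:M]` and (Γ) holds for `M` then it holds for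
`L` (`‖N_{L/M} x‖ = ‖x‖^d`, Bezout `a d = 1 + b p`). [cite: Tate1967, §3.2] -/
theorem exists_norm_pow_eq_of_not_dvd_finrank (L : IntermediateField M (NormedAlgClosure F))
    [FiniteDimensional M L] (hd : ¬ p ∣ finrank M L)
    (hΓ : ∀ x ∈ M, x ≠ 0 → ∃ c ∈ M, ‖c‖ ^ p = ‖x‖)
    {x : NormedAlgClosure F} (hx : x ∈ L) (hx0 : x ≠ 0) :
    ∃ c ∈ L, ‖c‖ ^ p = ‖x‖ := by
  have hprime : p.Prime := Fact.out
  set d : ℕ := finrank M L with hdd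
  -- `‖N x‖ = ‖x‖^d`, `‖N x‖ = ‖c₀‖^p`
  set n₁ : NormedAlgClosure F := ((Algebra.norm M (⟨x, hx⟩ : L) : M) : NormedAlgClosure F) with hn₁
  have hn₁M : n₁ ∈ M := (Algebra.norm M (⟨x, hx⟩ : L)).2
  have hnn₁ : ‖n₁‖ = ‖x‖ ^ d := by rw [hn₁, norm_norm_eq hp M L]
  have hn₁0 : n₁ ≠ 0 := by
    intro h; rw [h, norm_zero] at hnn₁
    exact pow_ne_zero d (norm_ne_zero_iff.mpr hx0) hnn₁.symm
  obtain ⟨c₀, hc₀M, hc₀⟩ := hΓ n₁ hn₁M hn₁0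
  have hc₀L : c₀ ∈ L := L.algebraMap_mem ⟨c₀, hc₀M⟩
  -- Bezout `d a = p b + 1`
  have hcop : Nat.Coprime d p := Nat.coprime_comm.mp ((Nat.Prime.coprime_iff_not_dvd hprime).mpr hd)
  obtain ⟨a, -, ha⟩ := Nat.exists_mul_mod_eq_one_of_coprime hcop hprime.one_lt
  set b : ℕ := d * a / p with hb
  have hda : d * a = p * b + 1 := by rw [hb, ← ha, Nat.div_add_mod]
  have h1 : ‖c₀‖ ^ (p * a) = ‖x‖ * ‖x‖ ^ (p * b) := by
    rw [pow_mul, hc₀, hnn₁, ← pow_mul, hda, pow_add, pow_one, mul_comm]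
  refine ⟨c₀ ^ a * (x ^ b)⁻¹, mul_mem (pow_mem hc₀L a) (inv_mem (pow_mem hx b)), ?_⟩
  rw [norm_mul, norm_inv, norm_pow, norm_pow, mul_pow, inv_pow, ← pow_mul, ← pow_mul, mul_comm a p, h1,
    mul_comm b p, mul_assoc, mul_inv_cancel₀ (pow_ne_zero _ (norm_ne_zero_iff.mpr hx0)), mul_one]

/-! ### §2 Monomials and sums of `p`-th powers -/

/-- **A monomial `β γ^p` (`β ∈ M`, `γ ∈ L`, `‖β γ^p‖ ≤ B`) is a `p`-th power up to `B ‖p‖^s`**, with a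
`p`-th root of norm `≤ B` (`β = t^p v` by (Γ), `v ≡ w^p` by (U_s)). [cite: Tate1967, §3.2] -/
theorem exists_pow_near_monomial (L : IntermediateField M (NormedAlgClosure F)) {s : ℝ} (hs : 0 < s)
    (hΓ : ∀ x ∈ M, x ≠ 0 → ∃ c ∈ M, ‖c‖ ^ p = ‖x‖)
    (hU : ∀ u ∈ M, ‖u‖ ≤ 1 → ∃ w ∈ M, ‖u - w ^ p‖ ≤ ‖(p : NormedAlgClosure F)‖ ^ s)
    {B : ℝ} (hB : 1 ≤ B) {β γ : NormedAlgClosure F} (hβ : β ∈ M) (hγ : γ ∈ L)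
    (hle : ‖β * γ ^ p‖ ≤ B) :
    ∃ y ∈ L, ‖y‖ ≤ B ∧ ‖β * γ ^ p - y ^ p‖ ≤ B * ‖(p : NormedAlgClosure F)‖ ^ s := by
  have hprime : p.Prime := Fact.out
  have hq0 : 0 < ‖(p : NormedAlgClosure F)‖ :=
    norm_pos_iff.mpr (Nat.cast_ne_zero.mpr hprime.ne_zero)
  have hq1 : ‖(p : NormedAlgClosure F)‖ < 1 := by
    rw [PadicBase.norm_natCast_closure hp]; exact PadicBase.norm_p_lt_one hp
  have hB0 : 0 ≤ B := zero_le_one.trans hB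
  rcases eq_or_ne β 0 with rfl | hβ0
  · refine ⟨0, zero_mem L, by rw [norm_zero]; exact hB0, ?_⟩
    rw [zero_mul, zero_pow hprime.ne_zero, sub_zero, norm_zero]; positivity
  obtain ⟨t, htM, ht⟩ := hΓ β hβ hβ0
  have ht0 : t ≠ 0 := by
    intro h; rw [h, norm_zero, zero_pow hprime.ne_zero] at ht; exact hβ0 (norm_eq_zero.mp ht.symm)
  set v : NormedAlgClosure F := β * (t ^ p)⁻¹ with hv
  have hvM : v ∈ M := mul_mem hβ (inv_mem (pow_mem htM p))
  have hvn : ‖v‖ = 1 := by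
    rw [hv, norm_mul, norm_inv, norm_pow, ht, mul_inv_cancel₀ (norm_ne_zero_iff.mpr hβ0)]
  obtain ⟨w, hwM, hw⟩ := hU v hvM hvn.le
  have hw1 : ‖w‖ ≤ 1 := by
    have h1 : ‖w ^ p‖ ≤ 1 := by
      have : w ^ p = v + -(v - w ^ p) := by ring
      rw [this]
      refine (IsUltrametricDist.norm_add_le_max _ _).trans (max_le hvn.le ?_)
      rw [norm_neg]; exact hw.trans (Real.rpow_le_one hq0.le hq1.le hs.le)
    rw [norm_pow] at h1
    exact (pow_le_one_iff_of_nonneg (norm_nonneg _) hprime.ne_zero).mp h1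
  have hβeq : β = t ^ p * v := by
    rw [hv, mul_comm, mul_assoc, inv_mul_cancel₀ (pow_ne_zero _ ht0), mul_one]
  have htL : t ∈ L := L.algebraMap_mem ⟨t, htM⟩
  have hwL : w ∈ L := L.algebraMap_mem ⟨w, hwM⟩
  refine ⟨t * w * γ, mul_mem (mul_mem htL hwL) hγ, ?_, ?_⟩
  · -- `‖t w γ‖ ≤ ‖t γ‖ ≤ B^{1/p} ≤ B`
    have h1 : ‖t * γ‖ ^ p ≤ B := by
      rw [norm_mul, mul_pow, ht, ← norm_pow, ← norm_mul]
      exact hle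
    have h2 : ‖t * γ‖ ≤ B := by
      by_contra h
      rw [not_le] at h
      have : B < ‖t * γ‖ ^ p := by
        calc B ≤ B ^ p := le_self_pow₀ hB hprime.ne_zero
          _ < ‖t * γ‖ ^ p := pow_lt_pow_left₀ h hB0 hprime.ne_zero
      exact absurd h1 (not_le.mpr this)
    calc ‖t * w * γ‖ = ‖t * γ‖ * ‖w‖ := by rw [norm_mul, norm_mul, norm_mul]; ring
      _ ≤ B * 1 := mul_le_mul h2 hw1 (norm_nonneg _) hB0
      _ = B := mul_one B
  · have : β * γ ^ p - (t * w * γ) ^ p = (t ^ p * γ ^ p) * (v - w ^ p) := by rw [hβeq]; ring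
    rw [this, norm_mul]
    have h3 : ‖t ^ p * γ ^ p‖ ≤ B := by
      have : ‖t ^ p * γ ^ p‖ = ‖β * γ ^ p‖ := by
        rw [hβeq, norm_mul, norm_mul, norm_mul, hvn, mul_one]
      rw [this]; exact hle
    exact mul_le_mul h3 hw (norm_nonneg _) hB0

omit [CharZero F] in
/-- **Termwise `p`-th power approximation sums** (cross terms `(Σ y)^p − Σ y^p` have norm `≤ ‖p‖ B^p`;
the step "`Σ x_i^p ≡ (Σ x_i)^p (mod p)`" of Scholze's Lemma 3.2 / Tate's Prop. 9 computation).
[cite: Scholze2012, Lemma 3.2] [cite: Tate1967, §3.2] -/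
theorem norm_sum_sub_pow_sum_le {ι : Type*} (S : Finset ι) (u y : ι → NormedAlgClosure F) {B r : ℝ}
    (hB : 1 ≤ B) (hr : 0 ≤ r) (hy : ∀ i ∈ S, ‖y i‖ ≤ B) (happrox : ∀ i ∈ S, ‖u i - y i ^ p‖ ≤ B * r) :
    ‖∑ i ∈ S, u i - (∑ i ∈ S, y i) ^ p‖ ≤ B ^ p * max ‖(p : NormedAlgClosure F)‖ r := by
  have hprime : p.Prime := Fact.out
  have hB0 : 0 ≤ B := zero_le_one.trans hB
  have hsplit : ∑ i ∈ S, u i - (∑ i ∈ S, y i) ^ p =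
      ∑ i ∈ S, (u i - y i ^ p) + -((∑ i ∈ S, y i) ^ p - ∑ i ∈ S, y i ^ p) := by
    have hsd : ∑ i ∈ S, (u i - y i ^ p) = ∑ i ∈ S, u i - ∑ i ∈ S, y i ^ p := Finset.sum_sub_distrib _ _
    rw [hsd]; ring
  rw [hsplit]
  refine (IsUltrametricDist.norm_add_le_max _ _).trans (max_le ?_ ?_)
  · refine (IsUltrametricDist.norm_sum_le_of_forall_le_of_nonneg (by positivity)
      fun i hi => (happrox i hi).trans ?_)
    calc B * r ≤ B ^ p * r := by
          refine mul_le_mul_of_nonneg_right (le_self_pow₀ hB hprime.ne_zero) hr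
      _ ≤ B ^ p * max ‖(p : NormedAlgClosure F)‖ r :=
          mul_le_mul_of_nonneg_left (le_max_right _ _) (pow_nonneg hB0 _)
  · rw [norm_neg]
    refine (norm_sum_pow_sub_sum_pow_le' hprime S y hB hy).trans ?_
    rw [mul_comm]
    exact mul_le_mul_of_nonneg_left (le_max_left _ _) (pow_nonneg hB0 _)

/-! ### §3 The radical step when `minpoly_M(α) = X^ℓ - c` and `‖p‖^δ ≤ ‖c‖ ≤ 1` -/

set_option synthInstance.maxHeartbeats 200000 in
set_option maxHeartbeats 1600000 in
/-- **(U) for `M(α)`, `α^ℓ = c`, when `X^ℓ - c` is the minimal polynomial and `‖p‖^δ ≤ ‖c‖ ≤ 1`**: every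
integer `u` of `M(α)` is a `p`-th power modulo `‖p‖^{min s 1 - p δ}`. The coordinates `b_j` of
`u = Σ b_j α^j` satisfy `‖b_j‖ ‖ℓ α^{ℓ-1}‖ ≤ ‖u‖` (`norm_repr_mul_norm_derivative_le`), so `‖b_j α^j‖ ≤ ‖c‖⁻¹`;
each monomial is `β_j (α^{k_j})^p` with `p k_j = j + ℓ m_j`, `β_j = b_j c^{-m_j} ∈ M`
(`exists_pow_near_monomial`), and the `p`-th roots add up (`norm_sum_sub_pow_sum_le`).
[cite: Tate1967, §3.2] [cite: Scholze2012, Lemma 3.2] -/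
theorem radical_exists_norm_sub_pow_le {ℓ : ℕ} (hℓ : ℓ.Prime) (hℓp : ℓ ≠ p) {s : ℝ} (hs : 0 < s)
    (hΓ : ∀ x ∈ M, x ≠ 0 → ∃ c ∈ M, ‖c‖ ^ p = ‖x‖)
    (hU : ∀ u ∈ M, ‖u‖ ≤ 1 → ∃ w ∈ M, ‖u - w ^ p‖ ≤ ‖(p : NormedAlgClosure F)‖ ^ s)
    {α : NormedAlgClosure F} {c : M} (hα : α ^ ℓ = (c : NormedAlgClosure F))
    (hmin : minpoly M α = X ^ ℓ - C c) {δ : ℝ}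
    (hcδ : ‖(p : NormedAlgClosure F)‖ ^ δ ≤ ‖(c : NormedAlgClosure F)‖)
    (hc1 : ‖(c : NormedAlgClosure F)‖ ≤ 1)
    {u : NormedAlgClosure F} (hu : u ∈ (↥M)⟮α⟯) (hu1 : ‖u‖ ≤ 1) :
    ∃ w ∈ (↥M)⟮α⟯, ‖u - w ^ p‖ ≤ ‖(p : NormedAlgClosure F)‖ ^ (min s 1 - p * δ) := by
  classical
  have hprime : p.Prime := Fact.out
  have hp0 : (p : NormedAlgClosure F) ≠ 0 := Nat.cast_ne_zero.mpr hprime.ne_zero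
  have hq0 : 0 < ‖(p : NormedAlgClosure F)‖ := norm_pos_iff.mpr hp0
  have hq1 : ‖(p : NormedAlgClosure F)‖ < 1 := by
    rw [PadicBase.norm_natCast_closure hp]; exact PadicBase.norm_p_lt_one hp
  have hℓp' : ¬ p ∣ ℓ := fun h => hℓp ((Nat.prime_dvd_prime_iff_eq hprime hℓ).mp h).symm
  have hnℓ : ‖(ℓ : NormedAlgClosure F)‖ = 1 := norm_natCast_eq_one_of_not_dvd hprime hq1 hℓp'
  -- norms of `c` and `α`
  have hcpos : 0 < ‖(c : NormedAlgClosure F)‖ := (Real.rpow_pos_of_pos hq0 δ).trans_le hcδ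
  have hc0 : (c : NormedAlgClosure F) ≠ 0 := norm_pos_iff.mp hcpos
  have hαℓ : ‖α‖ ^ ℓ = ‖(c : NormedAlgClosure F)‖ := by rw [← norm_pow, hα]
  have hα1 : ‖α‖ ≤ 1 := (pow_le_one_iff_of_nonneg (norm_nonneg _) hℓ.ne_zero).mp (hαℓ ▸ hc1)
  have hα0 : α ≠ 0 := by
    intro h; rw [h, norm_zero, zero_pow hℓ.ne_zero] at hαℓ; exact hc0 (norm_eq_zero.mp hαℓ.symm)
  -- the power basis of `L = M(α)`
  set L : IntermediateField M (NormedAlgClosure F) := (↥M)⟮α⟯ with hL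
  have hint : IsIntegral M α := ⟨X ^ ℓ - C c, monic_X_pow_sub_C c hℓ.ne_zero, by simp [hα]⟩
  haveI : FiniteDimensional M L := adjoin.finiteDimensional hint
  set pb : PowerBasis M L := adjoin.powerBasis hint with hpb
  have hgen' : pb.gen = AdjoinSimple.gen M α := by rw [hpb, adjoin.powerBasis_gen]
  have hgen : ((pb.gen : L) : NormedAlgClosure F) = α := by rw [hgen']; rfl
  have hgen1 : ‖((pb.gen : L) : NormedAlgClosure F)‖ ≤ 1 := by rw [hgen]; exact hα1
  have hminpb : minpoly M pb.gen = X ^ ℓ - C c := by rw [hgen', minpoly_gen M α, hmin]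
  -- the different `ℓ α^{ℓ-1}`
  have hder : ((aeval pb.gen (derivative (minpoly M pb.gen)) : L) : NormedAlgClosure F) =
      (ℓ : NormedAlgClosure F) * α ^ (ℓ - 1) := by
    rw [← IntermediateField.aeval_coe L pb.gen, hgen, hminpb, derivative_sub, derivative_X_pow,
      derivative_C, sub_zero, map_mul, aeval_C, map_natCast, map_pow, aeval_X]
  have hnder : ‖((aeval pb.gen (derivative (minpoly M pb.gen)) : L) : NormedAlgClosure F)‖ =
      ‖α‖ ^ (ℓ - 1) := by rw [hder, norm_mul, hnℓ, one_mul, norm_pow]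
  -- coordinates of `u`
  set z : L := ⟨u, hu⟩ with hz
  set B : ℝ := ‖(c : NormedAlgClosure F)‖⁻¹ with hB
  have hB1 : 1 ≤ B := by rw [hB]; exact one_le_inv₀ hcpos |>.mpr hc1
  have hB0 : 0 ≤ B := zero_le_one.trans hB1
  have hBδ : B ≤ ‖(p : NormedAlgClosure F)‖ ^ (-δ) := by
    rw [hB, Real.rpow_neg hq0.le]
    exact inv_anti₀ (Real.rpow_pos_of_pos hq0 δ) hcδ
  have hcoord : ∀ i : Fin pb.dim, ‖((pb.basis.repr z i : M) : NormedAlgClosure F)‖ ≤ B := by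
    intro i
    have h := norm_repr_mul_norm_derivative_le hp M pb hgen1 z i
    rw [hnder] at h
    have hαℓ1 : ‖(c : NormedAlgClosure F)‖ ≤ ‖α‖ ^ (ℓ - 1) := by
      rw [← hαℓ]; exact pow_le_pow_of_le_one (norm_nonneg _) hα1 (Nat.sub_le ℓ 1)
    have h2 : ‖((pb.basis.repr z i : M) : NormedAlgClosure F)‖ * ‖(c : NormedAlgClosure F)‖ ≤ 1 :=
      (mul_le_mul_of_nonneg_left hαℓ1 (norm_nonneg _)).trans (h.trans hu1)
    rw [hB, ← one_div, le_div_iff₀ hcpos]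
    exact h2
  have hzsum : u = ∑ i : Fin pb.dim, ((pb.basis.repr z i : M) : NormedAlgClosure F) * α ^ (i : ℕ) := by
    have h := congrArg (fun y : L => (y : NormedAlgClosure F)) (pb.basis.sum_repr z)
    change ((z : L) : NormedAlgClosure F) = _
    rw [← h]
    push_cast
    refine Finset.sum_congr rfl fun i _ => ?_
    rw [pb.basis_eq_pow i, Algebra.smul_def, IntermediateField.algebraMap_apply]
    push_cast
    rw [hgen]
  -- each monomial is `β (α^k)^p` with `β ∈ M`, hence nearly a `p`-th power
  have hdim : pb.dim = ℓ := by rw [hpb, adjoin.powerBasis_dim, hmin, natDegree_X_pow_sub_C]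
  have hcop : Nat.Coprime p ℓ := (Nat.coprime_primes hprime hℓ).mpr (Ne.symm hℓp)
  have hterm : ∀ i : Fin pb.dim, ∃ y ∈ L, ‖y‖ ≤ B ∧
      ‖((pb.basis.repr z i : M) : NormedAlgClosure F) * α ^ (i : ℕ) - y ^ p‖ ≤
        B * ‖(p : NormedAlgClosure F)‖ ^ s := by
    intro i
    -- `p k = i + ℓ m`
    obtain ⟨k, -, hk⟩ := Nat.exists_mul_mod_eq_of_coprime (i : ℕ) hcop hℓ.ne_zero
    set m : ℕ := p * k / ℓ with hm
    have him : (i : ℕ) % ℓ = (i : ℕ) := Nat.mod_eq_of_lt (lt_of_lt_of_eq i.2 hdim)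
    have hpk : p * k = ℓ * m + (i : ℕ) := by rw [hm, ← him, ← hk, Nat.div_add_mod]
    have hαi : α ^ (i : ℕ) = ((c : NormedAlgClosure F) ^ m)⁻¹ * (α ^ k) ^ p := by
      rw [← pow_mul, mul_comm k p, hpk, pow_add, pow_mul, hα, ← mul_assoc,
        inv_mul_cancel₀ (pow_ne_zero _ hc0), one_mul]
    have hβM : ((pb.basis.repr z i : M) : NormedAlgClosure F) * ((c : NormedAlgClosure F) ^ m)⁻¹ ∈ M :=
      mul_mem (pb.basis.repr z i).2 (inv_mem (pow_mem c.2 m))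
    have hγL : α ^ k ∈ L := pow_mem (mem_adjoin_simple_self _ α) k
    have hle : ‖((pb.basis.repr z i : M) : NormedAlgClosure F) * ((c : NormedAlgClosure F) ^ m)⁻¹ *
        (α ^ k) ^ p‖ ≤ B := by
      rw [mul_assoc, ← hαi, norm_mul, norm_pow]
      calc ‖((pb.basis.repr z i : M) : NormedAlgClosure F)‖ * ‖α‖ ^ (i : ℕ)
          ≤ B * 1 := mul_le_mul (hcoord i) (pow_le_one₀ (norm_nonneg _) hα1) (pow_nonneg (norm_nonneg _) _)
            hB0
        _ = B := mul_one B
    obtain ⟨y, hyL, hyB, hy⟩ := exists_pow_near_monomial hp M L hs hΓ hU hB1 hβM hγL hle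
    refine ⟨y, hyL, hyB, ?_⟩
    rwa [mul_assoc, ← hαi] at hy
  choose y hyL hyB hy using hterm
  refine ⟨∑ i, y i, sum_mem fun i _ => hyL i, ?_⟩
  rw [hzsum]
  refine (norm_sum_sub_pow_sum_le Finset.univ _ y hB1 (Real.rpow_nonneg hq0.le s)
    (fun i _ => hyB i) (fun i _ => hy i)).trans ?_
  -- `B^p max(q, q^s) ≤ q^{min s 1 - p δ}`
  have hmax : max ‖(p : NormedAlgClosure F)‖ (‖(p : NormedAlgClosure F)‖ ^ s) ≤
      ‖(p : NormedAlgClosure F)‖ ^ (min s 1) := by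
    refine max_le ?_ (Real.rpow_le_rpow_of_exponent_ge hq0 hq1.le (min_le_left s 1))
    have h := Real.rpow_le_rpow_of_exponent_ge hq0 hq1.le (min_le_right s 1)
    rwa [Real.rpow_one] at h
  have hBp : B ^ p ≤ ‖(p : NormedAlgClosure F)‖ ^ (-(p * δ)) := by
    calc B ^ p ≤ (‖(p : NormedAlgClosure F)‖ ^ (-δ)) ^ p := pow_le_pow_left₀ hB0 hBδ p
      _ = ‖(p : NormedAlgClosure F)‖ ^ (-(p * δ)) := by
          rw [← Real.rpow_natCast, ← Real.rpow_mul hq0.le]; ring_nf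
  calc B ^ p * max ‖(p : NormedAlgClosure F)‖ (‖(p : NormedAlgClosure F)‖ ^ s)
      ≤ ‖(p : NormedAlgClosure F)‖ ^ (-(p * δ)) * ‖(p : NormedAlgClosure F)‖ ^ (min s 1) :=
        mul_le_mul hBp hmax (le_max_of_le_left hq0.le) (Real.rpow_nonneg hq0.le _)
    _ = ‖(p : NormedAlgClosure F)‖ ^ (min s 1 - p * δ) := by
        rw [← Real.rpow_add hq0]; ring_nf

end TateAlmostEtale

end Literature.NumberTheory.PAdicHodge

end
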